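import Summits.NavierStokesRegularity.NavierStokesRegularity.Theses.ThinOrFatPincer
import Literature.Analysis.FluidPDE.KatoMaximalTime
import HarnessLib.Audit

/-!
# Birth skeleton (BC3) of the crux `ThinOrFatPincer.Inflation`

(crux item `stmt-NavierStokesRegularity-10484`, rank 3, route
`route-NavierStokesRegularity-ThinOrFatPincer`; tree path `Cruxes/Inflation/Lines/birth.lean`;
registrar `planner-skel-stmt-NavierStokesRegularity-10484-0`, 2026-08-17. The route predates the
Lean birth certificate; this file supplies BC3 retroactively. `ledger crux ls` at registration: no
workfiles — no `Disproof.lean`, no `_false_without_` obstruction, no landed `Negative/` lemma, no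
dead line.)

THE CRUX (fixed, the route's decl). Phase space `L³_σ` = weakly divergence-free `u₀ ∈ L³(ℝ³;ℝ³)`;
bad set `B_ν = {u₀ ∈ L³_σ : ¬ HasGlobalKatoSolution ν u₀}` (no global `C([0,∞);L³)` mild solution;
in the decl the abbreviation is written out, `Iff.rfl`-equal). INFLATION: for `ν > 0`, `u₀ ∈ B_ν`
and `ε > 0` there is `δ > 0` such that every `v₀ ∈ L³_σ` with `‖v₀ − (1+ε)u₀‖_{L³} < δ` lies in
`B_ν` — `(1+ε)B_ν ⊆ int B_ν`: a blow-up datum inflated by one percent blows up ROBUSTLY.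

THE CUT — the route's own foreseen layer-2 split ("Inflation ⇐ VM → EventualOpenCriterion →
Inflation", TWO-LAYER PLAN of the route header), made literal in the Kato class
(`IsKatoSolutionOn`, `HasGlobalKatoSolution`, `KatoMaximalTime.lean`). Robustness of the inflated
datum `w = (1+ε)u₀` is split into robustness SOMEWHERE ALONG ITS ORBIT plus transport back to
time `0` by the classical well-posedness theory:

* `stub_amplitudeMonotone` [open; M–XL] — VM, AMPLITUDE MONOTONICITY OF BLOW-UP (the pointwise
  shadow of Inflation): `u₀ ∈ B_ν ⇒ (1+ε)u₀ ∈ B_ν`. By the exact scaling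
  `hasGlobalKatoSolution_smul_iff` this is viscosity monotonicity `B_ν ⊆ B_ν'` (`ν' < ν`): "less
  viscosity never rescues a blow-up". It is the `L³`/Kato-class form of crux
  `ReynoldsMonotone.ViscosityMonotone` (card reynolds-monotone-bad-set K1, there for Schwartz data
  and classical lifespans). Why it might fail: transient shear turbulence has lifetimes fractal in
  (amplitude, Re) (Skufca–Yorke–Eckhardt 2006); the blow-up time of `u_t = DΔu + u^p` is
  non-monotone in `D` (Mizoguchi–Ninomiya–Yanagida 1998).
* `stub_eventualInterior` [open; XL — THE HEART, = the route's "EventualOpenCriterion"] — for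
  `u₀ ∈ B_ν`, `ε > 0` and the (by VM) bad datum `w = (1+ε)u₀`: SOME Kato solution `u` of `w` on
  some `[0,T)` passes, at some time `t₁ ∈ [0,T)`, through an `L³_σ`-INTERIOR point of `B_ν`
  (a whole `L³_σ`-ball about `u t₁` is bad). This is Inflation TRANSFERRED from the datum to its
  pre-blow-up slices: at `t₁ = 0` it IS Inflation (given `kato_local`), and the freedom `t₁ ↑
  T_max(w)` is the why-easier — an OPEN sufficient condition for blow-up is needed only for data
  that are already deep in their own blow-up (`‖u(t)‖_{L³} → ∞`, Seregin 2012; quantitative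
  concentration near `T_max`, Barker–Prange arXiv:1812.09115, Tao arXiv:1908.04958; Albritton's
  Besov blow-up criterion arXiv:1612.04439), AND strictly inflated, not for arbitrary `L³` data.
  Why it might fail: exactly the crux's risk — a fragile (positive-codimension) blow-up whose
  orbit never enters `int B_ν`; no open blow-up criterion for Navier–Stokes is known.
* `stub_sliceContinuity` [known, not in tree; L] — CONTINUOUS DEPENDENCE AT A FIXED PRE-BLOW-UP
  TIME (lower semicontinuity of the Kato lifespan + continuity of the data-to-solution map into
  `C([0,t₁];L³)`): if `u` is a Kato solution on `[0,T)` from `w₀` and `0 ≤ t₁ < T`, then data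
  `v₀ ∈ L³_σ` close to `w₀` in `L³` have Kato solutions living beyond `t₁` whose time-`t₁` slice
  is `L³`-close to `u t₁`. Kato 1984 Thm. 1 (local theory); Gallagher–Iftimie–Planchon 2003,
  proof of Thm. 3.1 (the compact-interval step uses only `u ∈ C([0,t₁];L³)`); uniqueness
  `kato_unique` (Furioli–Lemarié-Rieusset–Terraneo 2000) to pass from Kato's constructed solution
  to an arbitrary Kato-class `u`. Only the GLOBAL version (`GIP2003_L3_stability`) is in the tree.
* `stub_forwardInvariance` [known, not in tree; M] — FORWARD INVARIANCE OF GLOBAL SOLVABILITY: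
  if `v₀` has a global Kato solution and `v` is any Kato solution on `[0,T')` from `v₀`, every
  slice `v t₁`, `0 ≤ t₁ < T'`, has a global Kato solution (time-shift of the global solution —
  Fabes–Jones–Rivière semigroup property `IsMildNSSolutionBetween.trans`, a named fact of
  `MildSolution.lean` — plus `kato_unique` and the a.e.-insensitivity of the duality-form datum).

COMPOSITION (real, this file): `Inflation_of : Theses.ThinOrFatPincer.Inflation` — the ONLY
theorem concluding the crux, BY NAME, no hypotheses; it calls the four stubs by name and is
otherwise pure logic: VM makes `w = (1+ε)u₀` bad; the heart gives `T, u, t₁, ρ` with the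
`ρ`-ball about `u t₁` inside `B_ν`; slice continuity at `t₁` with tolerance `ρ` gives `δ`; a datum
`v₀` in the `δ`-ball about `w` with a global Kato solution would have a Kato solution `v` beyond
`t₁` with `v t₁` in the bad ball, while forward invariance makes `v t₁` good — contradiction.
Its CLOSED twin `Inflation_of_hyps : <sig 1> → <sig 2> → <sig 3> → <sig 4> → Inflation` (same
proof, the stub statements as hypotheses, no placeholder anywhere) is the registrar's evidence
file `bc/Inflation_birth_closed.lean` attached to the crux item.

Negatives index (`ledger negatives --problem NavierStokesRegularity`, 4 entries: SymmetryModuliCount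
FiniteTangentModuli, PerpetualPump Thesis, AdiabaticEddy CorrectorSolvable, Blowup
ClayNonuniqueness): no stub restates or needs any of them (none concerns `L³`/Kato data, lifespans
or the topology of the bad set). Disproof used: none exists for this crux.
-/

noncomputable section

open Set MeasureTheory Filter Topology Function
open Literature.Analysis.FluidPDE

namespace Summit.NavierStokesRegularity.NavierStokesRegularity.Cruxes.Inflation.Birth

set_option linter.unusedVariables false
set_option linter.dupNamespace false

local notation "ℝ³" => EuclideanSpace ℝ (Fin 3)

/-- **stub 1 — `stub_amplitudeMonotone` (VM, amplitude = viscosity monotonicity of blow-up;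
OPEN).** For `ν > 0`, a weakly divergence-free `u₀ ∈ L³` without global Kato solution, and
`ε > 0`, the inflated datum `(1+ε) • u₀` has no global Kato solution either:
`(1+ε) B_ν ⊆ B_ν`, equivalently (`hasGlobalKatoSolution_smul_iff`) `B_ν ⊆ B_ν'` for `ν' < ν`.
The pointwise shadow of the crux (Inflation gives it with `v₀ := (1+ε)u₀`); Kato-class form of
`ReynoldsMonotone.ViscosityMonotone`. Sources: SkufcaYorkeEckhardt2006,
MizoguchiNinomiyaYanagida1998 (why it might fail), RusinSverak2011 §1 (scaling). -/
theorem stub_amplitudeMonotone :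
    ∀ ν : ℝ, 0 < ν → ∀ u₀ : ℝ³ → ℝ³, MemLp u₀ 3 volume → IsWeaklyDivFree u₀ →
      ¬ HasGlobalKatoSolution ν u₀ → ∀ ε : ℝ, 0 < ε →
      ¬ HasGlobalKatoSolution ν ((1 + ε) • u₀) := by
  sorry

/-- **stub 2 — `stub_eventualInterior` (the heart, = the route's foreseen child
"EventualOpenCriterion"; OPEN).** For `ν > 0`, `u₀ ∈ B_ν`, `ε > 0`, and the bad inflated datum
`w = (1+ε) • u₀`: some Kato solution `u` of `w` on some `[0,T)` has a slice `u t₁`, `0 ≤ t₁ < T`,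
which is an `L³_σ`-interior point of the bad set — every weakly divergence-free `L³` field in the
`ρ`-ball about `u t₁` lacks a global Kato solution. Inflation transferred along the flow (at
`t₁ = 0` it is Inflation itself); the bet is that an open blow-up criterion holds for strictly
inflated data deep in their own blow-up. Sources: GallagherIftimiePlanchon2003 (openness of the
good set, the model statement), Seregin2012 / arXiv:1812.09115 / arXiv:1908.04958 /
arXiv:1612.04439 (structure near `T_max`), Hou2022PotentiallySingularNS, WangEtAl2025 (why it
might fail: fragile, unstable singularities). -/
theorem stub_eventualInterior :
    ∀ ν : ℝ, 0 < ν → ∀ u₀ : ℝ³ → ℝ³, MemLp u₀ 3 volume → IsWeaklyDivFree u₀ →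
      ¬ HasGlobalKatoSolution ν u₀ → ∀ ε : ℝ, 0 < ε →
      ¬ HasGlobalKatoSolution ν ((1 + ε) • u₀) →
      ∃ T : ℝ, 0 < T ∧ ∃ u : ℝ → ℝ³ → ℝ³, IsKatoSolutionOn T ν ((1 + ε) • u₀) u ∧
        ∃ t₁ ∈ Ico 0 T, ∃ ρ : ℝ, 0 < ρ ∧
          ∀ w : ℝ³ → ℝ³, MemLp w 3 volume → IsWeaklyDivFree w →
            eLpNorm (w - u t₁) 3 volume < ENNReal.ofReal ρ → ¬ HasGlobalKatoSolution ν w := by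
  sorry

/-- **stub 3 — `stub_sliceContinuity` (continuous dependence at a fixed pre-blow-up time; KNOWN,
not in tree).** If `u` is a Kato solution on `[0,T)` at viscosity `ν > 0` from `w₀` and
`0 ≤ t₁ < T`, then for every `ρ > 0` there is `δ > 0` such that every weakly divergence-free
`v₀ ∈ L³` with `‖v₀ − w₀‖_{L³} < δ` has a Kato solution `v` on some `[0,T')` with `t₁ < T'` and
`‖v t₁ − u t₁‖_{L³} < ρ` (lower semicontinuity of the lifespan and continuity of the solution map
into `C([0,t₁];L³)`; the datum `w₀ ∈ L³_σ` automatically, `IsKatoSolutionOn.memLp_initial`).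
Sources: Kato1984 Thm. 1; GallagherIftimiePlanchon2003, proof of Thm. 3.1 (compact-interval step);
FurioliLemarieRieussetTerraneo2000 = `kato_unique` (to reach an arbitrary Kato-class `u`). -/
theorem stub_sliceContinuity :
    ∀ ν : ℝ, 0 < ν → ∀ (w₀ : ℝ³ → ℝ³) (T : ℝ) (u : ℝ → ℝ³ → ℝ³), IsKatoSolutionOn T ν w₀ u →
      ∀ t₁ ∈ Ico 0 T, ∀ ρ : ℝ, 0 < ρ → ∃ δ : ℝ, 0 < δ ∧
        ∀ v₀ : ℝ³ → ℝ³, MemLp v₀ 3 volume → IsWeaklyDivFree v₀ →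
          eLpNorm (v₀ - w₀) 3 volume < ENNReal.ofReal δ →
          ∃ T' : ℝ, t₁ < T' ∧ ∃ v : ℝ → ℝ³ → ℝ³, IsKatoSolutionOn T' ν v₀ v ∧
            eLpNorm (v t₁ - u t₁) 3 volume < ENNReal.ofReal ρ := by
  sorry

/-- **stub 4 — `stub_forwardInvariance` (forward invariance of global solvability under the Kato
flow; KNOWN, not in tree).** If `v₀` has a global Kato solution at viscosity `ν > 0` and `v` is any
Kato solution on `[0,T')` from `v₀`, then every slice `v t₁`, `0 ≤ t₁ < T'`, has a global Kato
solution (the time-shift `s ↦ g (t₁ + s)` of the global solution `g`, which agrees with `v` a.e. at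
`t₁` by `kato_unique`; the duality-form datum only enters through integrals, so the value of the
shifted solution at time `0` may be reset to `v t₁`). Sources: FabesJonesRiviere1972 Thm. 2.1 /
LemarieRieusset2002 Thm. 11.2 (semigroup property, the named fact
`IsMildNSSolutionBetween.trans`), Kato1984 Thm. 1, FurioliLemarieRieussetTerraneo2000. -/
theorem stub_forwardInvariance :
    ∀ ν : ℝ, 0 < ν → ∀ v₀ : ℝ³ → ℝ³, HasGlobalKatoSolution ν v₀ →
      ∀ (T' : ℝ) (v : ℝ → ℝ³ → ℝ³), IsKatoSolutionOn T' ν v₀ v →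
        ∀ t₁ ∈ Ico 0 T', HasGlobalKatoSolution ν (v t₁) := by
  sorry

/-- **Birth composition (the skeleton theorem).** The crux BY NAME from the four registered
stubs, used by name; otherwise pure logic (see the module docstring). -/
theorem Inflation_of : Theses.ThinOrFatPincer.Inflation := by
  intro ν hν u₀ h3 hdiv hB ε hε
  -- the crux writes `HasGlobalKatoSolution` out; it is the abbreviation, definitionally
  have hB' : ¬ HasGlobalKatoSolution ν u₀ := hB
  -- stub 1 (VM): the inflated datum is bad
  have hBε : ¬ HasGlobalKatoSolution ν ((1 + ε) • u₀) :=
    stub_amplitudeMonotone ν hν u₀ h3 hdiv hB' ε hε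
  -- stub 2 (heart): its orbit passes through an interior point of the bad set at time `t₁`
  obtain ⟨T, hT, u, hu, t₁, ht₁, ρ, hρ, hball⟩ :=
    stub_eventualInterior ν hν u₀ h3 hdiv hB' ε hε hBε
  -- stub 3: continuous dependence at time `t₁` with tolerance `ρ`
  obtain ⟨δ, hδ, hdep⟩ := stub_sliceContinuity ν hν ((1 + ε) • u₀) T u hu t₁ ht₁ ρ hρ
  refine ⟨δ, hδ, fun v₀ hv3 hvdiv hdist hG => ?_⟩
  have hG' : HasGlobalKatoSolution ν v₀ := hG
  obtain ⟨T', hT', v, hv, hclose⟩ := hdep v₀ hv3 hvdiv hdist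
  have ht₁' : t₁ ∈ Ico 0 T' := ⟨ht₁.1, hT'⟩
  -- `v t₁` lies in the bad ball, yet (stub 4) it inherits a global Kato solution from `v₀`
  exact hball (v t₁) (hv.memLp ht₁') (hv.mild.1 t₁ ht₁') hclose
    (stub_forwardInvariance ν hν v₀ hG' T' v hv t₁ ht₁')

end Summit.NavierStokesRegularity.NavierStokesRegularity.Cruxes.Inflation.Birth
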